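import Literature.NumberTheory.Automorphic.GodementJacquetReflection
import Literature.NumberTheory.Automorphic.GodementJacquetDualTerm
import Literature.NumberTheory.Automorphic.GodementJacquetCenterMellin
import HarnessLib

/-!
# The case `n = 1` of the Godement–Jacquet analytic continuation (Tate's theorem): explicit polar
# terms from the singular defect

Topic `NumberTheory/Automorphic`; namespace `Literature.NumberTheory.Automorphic`. The rank-one case
of the discharge of `GodementJacquet1972_gjZeta_meromorphic` (Godement–Jacquet (1972), Thm. 13.8
for `n = 1` = Tate's Main Theorem 4.4.1: the zeta integral has a meromorphic continuation with at
most simple poles at `s = 0, 1`), assembled from the reflection identity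
(`GodementJacquetReflection`), the Mellin integrals over `A_G` (`GodementJacquetCenterMellin`), the
analyticity of the two integrals (`GodementJacquetGlobalHolomorphy`, `GodementJacquetDualTerm`) and
Bruhat functions (`BruhatFunction`, `AutomorphicKernelBruhat`):

* `gjSingDefect_fin_one` — for `n = 1`,
  `(Q' - Q)(x̃, ỹ, a) = λ⁻¹ ω'_{1-s}(ỹ a⁻¹ x̃⁻¹) Φ̂(0) - ω_s(x̃ a ỹ⁻¹) Φ(0)` (the only singular `1 × 1`
  matrix is `0`); `integral_gjSingDefect_fin_one` —
  **`∫_{A_G} (Q' - Q) dα = c_α (λ⁻¹ Φ̂(0)/(s - 1) - Φ(0)/s)`** for `Re s > 1`, independently of `x̃, ỹ`;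
* `integral_bruhat_mul_comp_mk_eq` — `∫_G β(g) u(gH) dν = c⁻¹ ∫_X u dμ`;
* `gjZeta_restrict_compl_fin_one_eq` — **for `Re s ≥ 4`,
  `Z^{<1}(Φ, s, φ, φ') = λ(D)⁻¹ ∫_G Φ̂(g⁻¹)|det g|^{s-1} 𝟙_{|det g|<1} ⟪φ', R(g) φ⟫ dν(g)
     + κ c⁻¹ c_α (λ(D)⁻¹ Φ̂(0)/(s-1) - Φ(0)/s) (∫_X conj φ' dμ)(∫_X φ dμ)`**;
* `meromorphic_add_mul_add_polar` — entire `+ L ·` entire `+ E (A/(s-1) - B/s)` is meromorphic;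
* `gjZeta_meromorphic_continuation_fin_one` — **the case `n = 1` of the named fact** (house Borel
  structure, any automorphic `μ`, any Haar `ν`, any `φ, φ' ∈ L²(X)`, `Φ ∈ 𝒮`): absolute convergence
  for `Re s > 4` and a meromorphic `g` on `ℂ` agreeing with `Z(Φ, ·, φ, φ')` there. The Haar
  measures on `𝔸_K`, `M_1(𝔸_K)`, `A_G` (inversion invariant: `A_G` is commutative), the Bruhat
  function and the normalisation constants are chosen inside the proof.

Everything is proved; no definitions.

## References

* R. Godement, H. Jacquet, *Zeta functions of simple algebras*, LNM 260 (1972), §13, Thm. 13.8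
  [GodementJacquet1972].
* J. Tate, in Cassels–Fröhlich (eds.), *Algebraic Number Theory* (1967), Ch. XV, Thm. 4.4.1
  [CasselsFrohlichANT1967].
-/

noncomputable section

open MeasureTheory Measure Set Filter Topology IsDedekindDomain NumberField
open Literature.MeasureTheory.Group
open scoped ENNReal NNReal ComplexConjugate MatrixGroups

namespace Literature.NumberTheory.Automorphic

-- the quotient carries the tree's Borel σ-algebra, not Mathlib's quotient σ-algebra
attribute [-instance] Quotient.instMeasurableSpace QuotientGroup.measurableSpace

section RankOneDefect

variable {K : Type} [Field K] [NumberField K]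

attribute [local instance] adelicBorel borelSpace_adelic locallyCompactSpace_adelic
  secondCountableTopology_gl_adelic

variable [MeasurableSpace (AdeleRing (𝓞 K) K)] [BorelSpace (AdeleRing (𝓞 K) K)]
  [MeasurableSpace (Matrix (Fin 1) (Fin 1) (AdeleRing (𝓞 K) K))]
  [BorelSpace (Matrix (Fin 1) (Fin 1) (AdeleRing (𝓞 K) K))]
  (lam : Measure (Matrix (Fin 1) (Fin 1) (AdeleRing (𝓞 K) K))) [lam.IsAddHaarMeasure] [lam.Regular]

omit [MeasurableSpace (AdeleRing (𝓞 K) K)] [BorelSpace (AdeleRing (𝓞 K) K)]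
  [BorelSpace (Matrix (Fin 1) (Fin 1) (AdeleRing (𝓞 K) K))] [lam.IsAddHaarMeasure] [lam.Regular] in
/-- **For `n = 1` the singular defect has two terms**:
`(Q' - Q)(x̃, ỹ, a) = λ⁻¹ ω'_{1-s}(ỹ a⁻¹ x̃⁻¹) Φ̂(0) - ω_s(x̃ a ỹ⁻¹) Φ(0)` (the only singular
`1 × 1` matrix is `0`, `gjThetaSing_fin_one`). [folklore] -/
theorem gjSingDefect_fin_one (Φ : Matrix (Fin 1) (Fin 1) (AdeleRing (𝓞 K) K) → ℂ) (s : ℂ)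
    (x₀ y₀ : (AdelicGroupData.gl 1 K).Adelic) (a : (AdelicGroupData.gl 1 K).center') :
    gjSingDefect lam Φ s x₀ y₀ a =
      ((lam (matrixFundamentalDomain 1 K)).toReal : ℂ)⁻¹ *
          (gjDualF 1 K (fun _ => (1 : ℂ)) ((1 : ℕ) - s) (y₀ * ((a : (AdelicGroupData.gl 1 K).Adelic))⁻¹ * x₀⁻¹) *
            adelicMatrixFourier 1 K lam Φ 0) -
        gjTruncF 1 K (fun _ => (1 : ℂ)) s (x₀ * (a : (AdelicGroupData.gl 1 K).Adelic) * y₀⁻¹) * Φ 0 := by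
  have e1 : gjThetaSing 1 K (adelicMatrixFourier 1 K lam Φ) (y₀ * ((a : (AdelicGroupData.gl 1 K).Adelic))⁻¹) x₀⁻¹ =
      adelicMatrixFourier 1 K lam Φ 0 := gjThetaSing_fin_one _ _ _
  have e2 : gjThetaSing 1 K Φ x₀ ((a : (AdelicGroupData.gl 1 K).Adelic) * y₀⁻¹) = Φ 0 := gjThetaSing_fin_one _ _ _
  unfold gjSingDefect
  -- generalize the `Adelic`-typed arguments to `GL`-typed variables, then rewrite
  set A : GL (Fin 1) (AdeleRing (𝓞 K) K) := y₀ * ((a : (AdelicGroupData.gl 1 K).Adelic))⁻¹ with hA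
  set B : GL (Fin 1) (AdeleRing (𝓞 K) K) := x₀⁻¹ with hB
  set C : GL (Fin 1) (AdeleRing (𝓞 K) K) := (a : (AdelicGroupData.gl 1 K).Adelic) * y₀⁻¹ with hC
  set X : GL (Fin 1) (AdeleRing (𝓞 K) K) := x₀ with hX
  set g₁ : GL (Fin 1) (AdeleRing (𝓞 K) K) := x₀ * (a : (AdelicGroupData.gl 1 K).Adelic) * y₀⁻¹ with hg₁
  set g₂ : GL (Fin 1) (AdeleRing (𝓞 K) K) := y₀ * ((a : (AdelicGroupData.gl 1 K).Adelic))⁻¹ * x₀⁻¹ with hg₂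
  rw [e1, e2]

variable {α : Measure (AdelicGroupData.gl 1 K).center'} [α.IsHaarMeasure] [α.IsInvInvariant] {cα : ℝ≥0}
  (hα : α.map (centerLog 1 K Nat.one_pos) = cα • (volume : Measure ℝ))

omit [MeasurableSpace (AdeleRing (𝓞 K) K)] [BorelSpace (AdeleRing (𝓞 K) K)]
  [BorelSpace (Matrix (Fin 1) (Fin 1) (AdeleRing (𝓞 K) K))] [lam.IsAddHaarMeasure] [lam.Regular]
  [α.IsHaarMeasure] in
include hα in
/-- **The `A_G`-integral of the singular defect for `n = 1`** (Tate's polar terms): for `Re s > 1`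
and all `x̃, ỹ`,
`∫_{A_G} (Q' - Q)(x̃, ỹ, a) dα(a) = c_α (λ⁻¹ Φ̂(0) / (s - 1) - Φ(0) / s)` — independent of `x̃, ỹ`
(`integrable_and_integral_gjTruncF_one_center`, `integrable_and_integral_gjDualF_one_center`).
[cite: GodementJacquet1972, §13] -/
theorem integral_gjSingDefect_fin_one (Φ : Matrix (Fin 1) (Fin 1) (AdeleRing (𝓞 K) K) → ℂ) {s : ℂ}
    (hs : 1 < s.re) (x₀ y₀ : (AdelicGroupData.gl 1 K).Adelic) :
    ∫ a, gjSingDefect lam Φ s x₀ y₀ a ∂α =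
      (cα : ℂ) * (((lam (matrixFundamentalDomain 1 K)).toReal : ℂ)⁻¹ * adelicMatrixFourier 1 K lam Φ 0 / (s - 1) -
        Φ 0 / s) := by
  have hs0 : 0 < s.re := by linarith
  have hw : (((1 : ℕ) : ℂ) - s).re < 0 := by simp; linarith
  obtain ⟨hI1, hV1⟩ := integrable_and_integral_gjTruncF_one_center (n := 1) Nat.one_pos hα hs0 x₀ y₀⁻¹
  obtain ⟨hI2, hV2⟩ := integrable_and_integral_gjDualF_one_center (n := 1) Nat.one_pos hα hw y₀ x₀⁻¹
  -- the dual weight appears with `a⁻¹`: use inversion invariance of `α`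
  have hI2' : Integrable (fun a : (AdelicGroupData.gl 1 K).center' =>
      gjDualF 1 K (fun _ => (1 : ℂ)) (((1 : ℕ) : ℂ) - s)
        (y₀ * ((a : (AdelicGroupData.gl 1 K).Adelic))⁻¹ * x₀⁻¹)) α := by
    have h := hI2.comp_inv
    refine h.congr (Eventually.of_forall fun a => ?_)
    simp only [Subgroup.coe_inv]
  have hV2' : ∫ a : (AdelicGroupData.gl 1 K).center',
      gjDualF 1 K (fun _ => (1 : ℂ)) (((1 : ℕ) : ℂ) - s)
        (y₀ * ((a : (AdelicGroupData.gl 1 K).Adelic))⁻¹ * x₀⁻¹) ∂α = -(cα : ℂ) / (((1 : ℕ) : ℂ) - s) := by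
    rw [← hV2, ← integral_inv_eq_self (μ := α)
      (fun a : (AdelicGroupData.gl 1 K).center' =>
        gjDualF 1 K (fun _ => (1 : ℂ)) (((1 : ℕ) : ℂ) - s) (y₀ * (a : (AdelicGroupData.gl 1 K).Adelic) * x₀⁻¹))]
    refine integral_congr_ae (Eventually.of_forall fun a => ?_)
    simp only [Subgroup.coe_inv]
  have heq : (fun a => gjSingDefect lam Φ s x₀ y₀ a) = fun a : (AdelicGroupData.gl 1 K).center' =>
      ((lam (matrixFundamentalDomain 1 K)).toReal : ℂ)⁻¹ * adelicMatrixFourier 1 K lam Φ 0 *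
          gjDualF 1 K (fun _ => (1 : ℂ)) (((1 : ℕ) : ℂ) - s)
            (y₀ * ((a : (AdelicGroupData.gl 1 K).Adelic))⁻¹ * x₀⁻¹) -
        Φ 0 * gjTruncF 1 K (fun _ => (1 : ℂ)) s (x₀ * (a : (AdelicGroupData.gl 1 K).Adelic) * y₀⁻¹) := by
    funext a
    rw [gjSingDefect_fin_one]
    ring
  rw [show (∫ a, gjSingDefect lam Φ s x₀ y₀ a ∂α) = ∫ a, (fun a => gjSingDefect lam Φ s x₀ y₀ a) a ∂α from rfl,
    heq, integral_sub (hI2'.const_mul _) (hI1.const_mul _), integral_const_mul, integral_const_mul, hV2', hV1]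
  have hs1 : (s - 1) ≠ 0 := by
    intro h; have := congrArg Complex.re h; simp at this; linarith
  have hs1' : (((1 : ℕ) : ℂ) - s) ≠ 0 := by
    intro h; apply hs1; simp at h; linear_combination -h
  have hsne : s ≠ 0 := by
    intro h; rw [h] at hs0; simp at hs0
  field_simp
  push_cast
  ring

end RankOneDefect

/-! ### The truncated zeta integral for `n = 1`: dual term plus explicit polar terms -/

section RankOneFormula

variable {K : Type} [Field K] [NumberField K]

attribute [local instance] adelicBorel borelSpace_adelic locallyCompactSpace_adelic
  secondCountableTopology_gl_adelic measurableSpaceQuotient borelSpaceQuotient glBorel borelSpace_glBorel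
  isHaarMeasure_glForm

variable [MeasurableSpace (AdeleRing (𝓞 K) K)] [BorelSpace (AdeleRing (𝓞 K) K)]
  [MeasurableSpace (Matrix (Fin 1) (Fin 1) (AdeleRing (𝓞 K) K))]
  [BorelSpace (Matrix (Fin 1) (Fin 1) (AdeleRing (𝓞 K) K))]
  (lam : Measure (Matrix (Fin 1) (Fin 1) (AdeleRing (𝓞 K) K))) [lam.IsAddHaarMeasure] [lam.Regular]
  (μ : Measure (AdelicGroupData.gl 1 K).automorphicQuotient)
  [(AdelicGroupData.gl 1 K).IsAutomorphicMeasure μ]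
  (ν : Measure (AdelicGroupData.gl 1 K).Adelic) [ν.IsHaarMeasure]

attribute [local instance] smulInvariantMeasureQuotient isFiniteMeasureOnCompactsQuotient

omit [MeasurableSpace (AdeleRing (𝓞 K) K)] [BorelSpace (AdeleRing (𝓞 K) K)]
  [MeasurableSpace (Matrix (Fin 1) (Fin 1) (AdeleRing (𝓞 K) K))]
  [BorelSpace (Matrix (Fin 1) (Fin 1) (AdeleRing (𝓞 K) K))] in
/-- Through a Bruhat function: `∫_G β(g) u(gH) dν(g) = c⁻¹ ∫_X u dμ` for `u ∈ L¹(X)`, complex-valued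
version with the Bruhat weight as a complex factor. [folklore] -/
theorem integral_bruhat_mul_comp_mk_eq {n : ℕ} (μ : Measure (AdelicGroupData.gl n K).automorphicQuotient)
    [(AdelicGroupData.gl n K).IsAutomorphicMeasure μ]
    (ν : Measure (AdelicGroupData.gl n K).Adelic) [ν.IsHaarMeasure]
    {β : (AdelicGroupData.gl n K).Adelic → ℝ}
    (hβ : IsBruhatFunction (AdelicGroupData.gl n K).quotientSubgroup (quotientSubgroupHaar n K) β)
    {u : (AdelicGroupData.gl n K).automorphicQuotient → ℂ} (hu : Integrable u μ) :
    ∫ g, (β g : ℂ) * u ((AdelicGroupData.gl n K).toAutomorphicQuotient g) ∂ν =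
      ((automorphicUnfoldingConstant n K μ ν : ℝ) : ℂ)⁻¹ * ∫ x, u x ∂μ := by
  have hc : automorphicUnfoldingConstant n K μ ν ≠ 0 := (automorphicUnfoldingConstant_pos n K μ ν).ne'
  have hc' : ((automorphicUnfoldingConstant n K μ ν : ℝ) : ℂ) ≠ 0 := by exact_mod_cast hc
  have h : ∫ x, u x ∂μ = (automorphicUnfoldingConstant n K μ ν) •
      ∫ g, β g • u ((AdelicGroupData.gl n K).toAutomorphicQuotient g) ∂ν :=
    integral_eq_smul_integral_bruhat _ _ μ ν hc hβ hu
  have h2 : ∫ g, β g • u ((AdelicGroupData.gl n K).toAutomorphicQuotient g) ∂ν =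
      ∫ g, (β g : ℂ) * u ((AdelicGroupData.gl n K).toAutomorphicQuotient g) ∂ν :=
    integral_congr_ae (Eventually.of_forall fun g => Complex.real_smul)
  rw [h, NNReal.smul_def, Complex.real_smul, h2, ← mul_assoc, inv_mul_cancel₀ hc', one_mul]

/-- **The truncated zeta integral for `n = 1`** (Tate's computation inside the Godement–Jacquet
method): for `Φ ∈ 𝒮(𝔸_K)` (as `1 × 1` matrices), `φ, φ' ∈ L²(X)`, `Re s ≥ 4`,
`Z^{<1}(Φ, s, φ, φ') = λ(D)⁻¹ ∫_G F''(g) ⟪φ', R(g) φ⟫ dν(g)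
   + κ c⁻¹ c_α (λ(D)⁻¹ Φ̂(0)/(s - 1) - Φ(0)/s) (∫_X conj φ' dμ) (∫_X φ dμ)`
with `F''(g) = Φ̂(g⁻¹) |det g|^{s-1} 𝟙_{|det g|<1}`, `c` the unfolding constant, `κ` and `c_α` the
normalisations of `ρ_H ↦ κ (α ⊗ #)` and `centerLog_* α = c_α dv`
(`gjZeta_restrict_compl_sub_dual_eq_integral_gjSingDefect`, `integral_gjSingDefect_fin_one`, and
integration back over `X` through the Bruhat function). [cite: GodementJacquet1972, §13] -/
theorem gjZeta_restrict_compl_fin_one_eq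
    {Φ : Matrix (Fin 1) (Fin 1) (AdeleRing (𝓞 K) K) → ℂ} (hΦ : Φ ∈ schwartzBruhatAdelicMatrix 1 K)
    (φ φ' : (AdelicGroupData.gl 1 K).L2 μ) {s : ℂ} (hs : (4 : ℝ) ≤ s.re)
    {β : (AdelicGroupData.gl 1 K).Adelic → ℝ}
    (hβ : IsBruhatFunction (AdelicGroupData.gl 1 K).quotientSubgroup (quotientSubgroupHaar 1 K) β)
    {α : Measure (AdelicGroupData.gl 1 K).center'} [α.IsHaarMeasure] [α.IsInvInvariant] {κ : ℝ≥0}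
    (hκ : (quotientSubgroupHaar 1 K).map (quotientSubgroupEquiv 1 K) =
      κ • α.prod (count : Measure (AdelicGroupData.gl 1 K).arithmeticSubgroup))
    {cα : ℝ≥0} (hα : α.map (centerLog 1 K Nat.one_pos) = cα • (volume : Measure ℝ)) :
    gjZeta μ (ν.restrict (detAtLeastOne 1 K)ᶜ) Φ φ φ' s -
        ((lam (matrixFundamentalDomain 1 K)).toReal : ℂ)⁻¹ *
          ∫ g : GL (Fin 1) (AdeleRing (𝓞 K) K),
            gjDualF 1 K (adelicMatrixFourier 1 K lam Φ) (((1 : ℕ) : ℂ) - s) g⁻¹ * glMatrixCoeff μ φ φ' g ∂ν =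
      (κ : ℂ) * ((automorphicUnfoldingConstant 1 K μ ν : ℝ) : ℂ)⁻¹ *
        ((cα : ℂ) * (((lam (matrixFundamentalDomain 1 K)).toReal : ℂ)⁻¹ * adelicMatrixFourier 1 K lam Φ 0 / (s - 1) -
          Φ 0 / s)) *
        (∫ x, conj ((φ' : (AdelicGroupData.gl 1 K).automorphicQuotient → ℂ) x) ∂μ) *
        (∫ x, (φ : (AdelicGroupData.gl 1 K).automorphicQuotient → ℂ) x ∂μ) := by
  have hs1 : 1 < s.re := by linarith
  have hs' : ((1 : ℕ) : ℝ) * (1 : ℕ) + (1 : ℕ) + 2 ≤ s.re := by norm_num; linarith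
  -- the reflection identity, read with the house names
  have h0 : gjZeta μ (ν.restrict (detAtLeastOne 1 K)ᶜ) Φ φ φ' s -
        ((lam (matrixFundamentalDomain 1 K)).toReal : ℂ)⁻¹ *
          ∫ g : GL (Fin 1) (AdeleRing (𝓞 K) K),
            gjDualF 1 K (adelicMatrixFourier 1 K lam Φ) (((1 : ℕ) : ℂ) - s) g⁻¹ * glMatrixCoeff μ φ φ' g ∂ν =
      ((automorphicUnfoldingConstant 1 K μ ν : ℝ) : ℂ) *
        ∫ x₀ : (AdelicGroupData.gl 1 K).Adelic, (β x₀ : ℂ) *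
          (conj ((φ' : (AdelicGroupData.gl 1 K).automorphicQuotient → ℂ) ((AdelicGroupData.gl 1 K).toAutomorphicQuotient x₀)) *
            ∫ y₀ : (AdelicGroupData.gl 1 K).Adelic, (β y₀ : ℂ) *
              (((κ : ℝ) • ∫ a, gjSingDefect lam Φ s x₀ y₀ a ∂α) *
                (φ : (AdelicGroupData.gl 1 K).automorphicQuotient → ℂ) ((AdelicGroupData.gl 1 K).toAutomorphicQuotient y₀)) ∂ν) ∂ν :=
    gjZeta_restrict_compl_sub_dual_eq_integral_gjSingDefect lam μ ν hΦ φ φ' hs' hβ hκ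
  -- the singular defect integrates to a constant
  set D : ℂ := (cα : ℂ) * (((lam (matrixFundamentalDomain 1 K)).toReal : ℂ)⁻¹ * adelicMatrixFourier 1 K lam Φ 0 / (s - 1) -
    Φ 0 / s) with hD
  have hdef : ∀ x₀ y₀ : (AdelicGroupData.gl 1 K).Adelic, ∫ a, gjSingDefect lam Φ s x₀ y₀ a ∂α = D :=
    fun x₀ y₀ => integral_gjSingDefect_fin_one lam hα Φ hs1 x₀ y₀
  have h1 : ∀ x₀ : (AdelicGroupData.gl 1 K).Adelic,
      ∫ y₀ : (AdelicGroupData.gl 1 K).Adelic, (β y₀ : ℂ) *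
          (((κ : ℝ) • ∫ a, gjSingDefect lam Φ s x₀ y₀ a ∂α) *
            (φ : (AdelicGroupData.gl 1 K).automorphicQuotient → ℂ) ((AdelicGroupData.gl 1 K).toAutomorphicQuotient y₀)) ∂ν =
        ((κ : ℂ) * D) * ∫ y₀ : (AdelicGroupData.gl 1 K).Adelic, (β y₀ : ℂ) *
          (φ : (AdelicGroupData.gl 1 K).automorphicQuotient → ℂ) ((AdelicGroupData.gl 1 K).toAutomorphicQuotient y₀) ∂ν := by
    intro x₀
    rw [← integral_const_mul]
    refine integral_congr_ae (Eventually.of_forall fun y₀ => ?_)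
    simp only [hdef, Complex.real_smul]
    ring
  simp only [h1] at h0
  set M : ℂ := ((κ : ℂ) * D) * ∫ y₀ : (AdelicGroupData.gl 1 K).Adelic, (β y₀ : ℂ) *
    (φ : (AdelicGroupData.gl 1 K).automorphicQuotient → ℂ) ((AdelicGroupData.gl 1 K).toAutomorphicQuotient y₀) ∂ν with hM
  have h2 : ∫ x₀ : (AdelicGroupData.gl 1 K).Adelic, (β x₀ : ℂ) *
      (conj ((φ' : (AdelicGroupData.gl 1 K).automorphicQuotient → ℂ) ((AdelicGroupData.gl 1 K).toAutomorphicQuotient x₀)) * M) ∂ν =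
      M * ∫ x₀ : (AdelicGroupData.gl 1 K).Adelic, (β x₀ : ℂ) *
        conj ((φ' : (AdelicGroupData.gl 1 K).automorphicQuotient → ℂ) ((AdelicGroupData.gl 1 K).toAutomorphicQuotient x₀)) ∂ν := by
    rw [← integral_const_mul]
    refine integral_congr_ae (Eventually.of_forall fun x₀ => ?_)
    simp only []
    ring
  rw [h2] at h0
  -- back to `X` through the Bruhat function
  have hφ1 : Integrable (fun x => (φ : (AdelicGroupData.gl 1 K).automorphicQuotient → ℂ) x) μ :=
    (Lp.memLp φ).integrable one_le_two
  have hψ1 : Integrable (fun x => conj ((φ' : (AdelicGroupData.gl 1 K).automorphicQuotient → ℂ) x)) μ :=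
    (memLp_two_conj (Lp.memLp φ')).integrable one_le_two
  have hJe : ∫ y₀ : (AdelicGroupData.gl 1 K).Adelic, (β y₀ : ℂ) *
      (φ : (AdelicGroupData.gl 1 K).automorphicQuotient → ℂ) ((AdelicGroupData.gl 1 K).toAutomorphicQuotient y₀) ∂ν =
      ((automorphicUnfoldingConstant 1 K μ ν : ℝ) : ℂ)⁻¹ *
        ∫ x, (φ : (AdelicGroupData.gl 1 K).automorphicQuotient → ℂ) x ∂μ :=
    integral_bruhat_mul_comp_mk_eq μ ν hβ hφ1
  have hJ'e : ∫ x₀ : (AdelicGroupData.gl 1 K).Adelic, (β x₀ : ℂ) *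
      conj ((φ' : (AdelicGroupData.gl 1 K).automorphicQuotient → ℂ) ((AdelicGroupData.gl 1 K).toAutomorphicQuotient x₀)) ∂ν =
      ((automorphicUnfoldingConstant 1 K μ ν : ℝ) : ℂ)⁻¹ *
        ∫ x, conj ((φ' : (AdelicGroupData.gl 1 K).automorphicQuotient → ℂ) x) ∂μ :=
    integral_bruhat_mul_comp_mk_eq μ ν hβ hψ1
  rw [h0, hM, hJe, hJ'e]
  have hc' : ((automorphicUnfoldingConstant 1 K μ ν : ℝ) : ℂ) ≠ 0 := by
    exact_mod_cast (automorphicUnfoldingConstant_pos 1 K μ ν).ne'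
  field_simp

end RankOneFormula

/-! ### Meromorphy of the continuation and the case `n = 1` of the named fact -/

section RankOneContinuation

variable {K : Type} [Field K] [NumberField K]

/-- The shape of the continuation for `n = 1`: entire + `L ·` entire + `E (A/(s-1) - B/s)` is
meromorphic on `ℂ`. [folklore] -/
theorem meromorphic_add_mul_add_polar {gZ gM : ℂ → ℂ} (hZ : Differentiable ℂ gZ) (hM : Differentiable ℂ gM)
    (L E A B : ℂ) :
    Meromorphic fun s : ℂ => gZ s + (L * gM s + E * (A * (s - 1)⁻¹ - B * s⁻¹)) := by
  intro z
  have h1 : MeromorphicAt (fun s : ℂ => (s - 1)⁻¹) z :=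
    ((MeromorphicAt.id z).sub (MeromorphicAt.const 1 z)).inv
  have h2 : MeromorphicAt (fun s : ℂ => s⁻¹) z := (MeromorphicAt.id z).inv
  have h3 : MeromorphicAt (fun s : ℂ => E * (A * (s - 1)⁻¹ - B * s⁻¹)) z :=
    (MeromorphicAt.const E z).mul (((MeromorphicAt.const A z).mul h1).sub ((MeromorphicAt.const B z).mul h2))
  have h4 : MeromorphicAt (fun s : ℂ => L * gM s) z := (MeromorphicAt.const L z).mul (hM.analyticAt z).meromorphicAt
  exact (hZ.analyticAt z).meromorphicAt.add (h4.add h3)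

attribute [local instance] adelicBorel borelSpace_adelic locallyCompactSpace_adelic
  secondCountableTopology_gl_adelic measurableSpaceQuotient borelSpaceQuotient glBorel borelSpace_glBorel
  isHaarMeasure_glForm smulInvariantMeasureQuotient isFiniteMeasureOnCompactsQuotient
  secondCountableTopology_adeleRing locallyCompactSpace_adeleRing'

/-- **The Godement–Jacquet analytic continuation for `n = 1` (Tate's theorem)**, in the form of the
named fact `GodementJacquet1972_gjZeta_meromorphic` for `GL₁` with the house Borel structure: for
`Φ ∈ 𝒮(𝔸_K)`, `φ, φ' ∈ L²(X)`, an automorphic measure `μ` and a Haar measure `ν`, the zeta integral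
converges absolutely for `Re s > 4` and is represented there by the meromorphic function
`Z^{≥1}(s) + λ(D)⁻¹ ∫_G Φ̂(g⁻¹)|det g|^{s-1} 𝟙_{|det g|<1} ⟪φ', R(g) φ⟫ dg + E (λ(D)⁻¹ Φ̂(0)/(s-1) - Φ(0)/s)`
(both integrals entire). Godement–Jacquet (1972), Thm. 13.8 for `n = 1`; Tate (1967), Thm. 4.4.1.
[cite: GodementJacquet1972, Thm. 13.8] -/
theorem gjZeta_meromorphic_continuation_fin_one
    (μ : Measure (AdelicGroupData.gl 1 K).automorphicQuotient) [(AdelicGroupData.gl 1 K).IsAutomorphicMeasure μ]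
    {Φ : Matrix (Fin 1) (Fin 1) (AdeleRing (𝓞 K) K) → ℂ} (hΦ : Φ ∈ schwartzBruhatAdelicMatrix 1 K)
    (φ φ' : (AdelicGroupData.gl 1 K).L2 μ) (ν : Measure (AdelicGroupData.gl 1 K).Adelic) [ν.IsHaarMeasure] :
    ∃ x₀ : ℝ, (∀ s : ℂ, x₀ < s.re → Integrable (gjZetaIntegrand μ Φ φ φ' s) ν) ∧
      ∃ g : ℂ → ℂ, Meromorphic g ∧ ∀ s : ℂ, x₀ < s.re → g s = gjZeta μ ν Φ φ φ' s := by
  -- Borel structures and Haar measures on `𝔸_K` and `M_1(𝔸_K)`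
  letI mA : MeasurableSpace (AdeleRing (𝓞 K) K) := borel _
  haveI : BorelSpace (AdeleRing (𝓞 K) K) := ⟨rfl⟩
  letI mM : MeasurableSpace (Matrix (Fin 1) (Fin 1) (AdeleRing (𝓞 K) K)) := borel _
  haveI : BorelSpace (Matrix (Fin 1) (Fin 1) (AdeleRing (𝓞 K) K)) := ⟨rfl⟩
  haveI : LocallyCompactSpace (Matrix (Fin 1) (Fin 1) (AdeleRing (𝓞 K) K)) :=
    Pi.locallyCompactSpace_of_finite
  set lam : Measure (Matrix (Fin 1) (Fin 1) (AdeleRing (𝓞 K) K)) := Measure.addHaar with hlam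
  -- a Bruhat function of `H = A_G · GL_1(K)`
  obtain ⟨β, hβ⟩ := exists_isBruhatFunction (AdelicGroupData.gl 1 K).quotientSubgroup (quotientSubgroupHaar 1 K)
    inferInstance
  -- Haar measure on `A_G`, inversion invariant (`A_G` is commutative)
  set α : Measure (AdelicGroupData.gl 1 K).center' := Measure.haar with hαdef
  haveI : IsMulCommutative ℝ≥0ˣ := ⟨⟨mul_comm⟩⟩
  haveI : IsMulCommutative (AdelicGroupData.gl 1 K).center' := Subgroup.range_isMulCommutative (posRealScalar 1 K)
  haveI : α.IsInvInvariant := by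
    open scoped IsMulCommutative in exact IsHaarMeasure.isInvInvariant_of_regular α
  obtain ⟨κ, -, hκ⟩ := exists_map_quotientSubgroupEquiv_eq_smul_prod (quotientSubgroupHaar 1 K) α
  obtain ⟨cα, -, hα⟩ := exists_map_centerLog_eq_smul_volume (n := 1) Nat.one_pos α
  -- the abscissa and clause (1)
  have hΦc : Continuous fun x : GL (Fin 1) (AdeleRing (𝓞 K) K) => Φ (x : Matrix (Fin 1) (Fin 1) (AdeleRing (𝓞 K) K)) :=
    (continuous_of_mem_schwartzBruhatAdelicMatrix hΦ).comp Units.continuous_val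
  have hmaj : ∀ σ : ℝ, (4 : ℝ) ≤ σ → Integrable (fun x : GL (Fin 1) (AdeleRing (𝓞 K) K) =>
      ‖Φ (x : Matrix (Fin 1) (Fin 1) (AdeleRing (𝓞 K) K))‖ * (adelicAbsDet 1 K x : ℝ) ^ σ)
      (ν : Measure (GL (Fin 1) (AdeleRing (𝓞 K) K))) := fun σ hσ =>
    integrable_norm_mul_adelicAbsDet_rpow_of_mem_schwartzBruhat (ν : Measure (GL (Fin 1) (AdeleRing (𝓞 K) K))) hΦ
      (by norm_num; linarith)
  have hint : ∀ s : ℂ, (4 : ℝ) < s.re → Integrable (gjZetaIntegrand μ Φ φ φ' s) ν := fun s hs =>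
    integrable_gjZetaIntegrand_of_integrable_norm_mul_rpow
      (aestronglyMeasurable_gjZetaIntegrand hΦc φ φ' s _) (hmaj s.re hs.le)
  -- the pieces of the continuation
  set L : ℂ := ((lam (matrixFundamentalDomain 1 K)).toReal : ℂ)⁻¹ with hL
  set E : ℂ := (κ : ℂ) * ((automorphicUnfoldingConstant 1 K μ ν : ℝ) : ℂ)⁻¹ *
    (cα : ℂ) * (∫ x, conj ((φ' : (AdelicGroupData.gl 1 K).automorphicQuotient → ℂ) x) ∂μ) *
      (∫ x, (φ : (AdelicGroupData.gl 1 K).automorphicQuotient → ℂ) x ∂μ) with hE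
  set gZ : ℂ → ℂ := gjZeta μ ((ν : Measure (GL (Fin 1) (AdeleRing (𝓞 K) K))).restrict (detAtLeastOne 1 K)) Φ φ φ' with hgZ
  set gM : ℂ → ℂ := fun s => ∫ g : GL (Fin 1) (AdeleRing (𝓞 K) K),
    gjDualF 1 K (adelicMatrixFourier 1 K lam Φ) (((1 : ℕ) : ℂ) - s) g⁻¹ * glMatrixCoeff μ φ φ' g ∂ν with hgM
  have hgZd : Differentiable ℂ gZ :=
    differentiable_gjZeta_restrict_detAtLeastOne hΦc φ φ' (x₀ := 4) fun σ hσ => hmaj σ hσ.le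
  have hgMd : Differentiable ℂ gM :=
    differentiable_integral_gjDualF_inv_mul_glMatrixCoeff μ (adelicMatrixFourier_mem_schwartzBruhatAdelicMatrix lam hΦ) φ φ' ν
  refine ⟨4, hint, fun s => gZ s + (L * gM s + E * (L * adelicMatrixFourier 1 K lam Φ 0 * (s - 1)⁻¹ - Φ 0 * s⁻¹)),
    meromorphic_add_mul_add_polar hgZd hgMd L E _ _, fun s hs => ?_⟩
  -- agreement on `Re s > 4`
  rw [gjZeta_eq_restrict_add_restrict_compl (ν : Measure (GL (Fin 1) (AdeleRing (𝓞 K) K))) (hint s hs)]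
  change gZ s + _ = gZ s + gjZeta μ (ν.restrict (detAtLeastOne 1 K)ᶜ) Φ φ φ' s
  congr 1
  have h := gjZeta_restrict_compl_fin_one_eq lam μ ν hΦ φ φ' (s := s) hs.le hβ hκ hα
  rw [sub_eq_iff_eq_add] at h
  rw [h, hE]
  ring

end RankOneContinuation

end Literature.NumberTheory.Automorphic
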